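import Mathlib
import HarnessLib
import Summits.Ventures.LatticeQCDFlow.Exactness.NCMCGeneralSpaceRestartChainEveryStart
import Summits.Ventures.LatticeQCDFlow.Exactness.NCMCGeneralSpaceWilsonHeatBathBar

/-!
# The engine's Jarzynski lane on the torus from EVERY initial gauge field: heat-bath link sweeps between launches

HONEST FRAMING: exact (Metropolis-corrected) sampling algorithms for lattice gauge theory;
figures of merit are autocorrelation/cost numbers at stated couplings and volumes; no
continuum-physics claim.

Venture `LatticeQCDFlow` (cell pub-lqcd), topic `Exactness`; FANOUT row 13 (`eng-snf`, GEN-18).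
NEW WORK of the cell, not a published result; no definition is introduced; nothing is cited as a
fact.  The engine instance of `NCMCGeneralSpaceRestartChainEveryStart.lean` (GEN-18: the restart
chain of records with a minorised level sampler converges from every initial record law), with row 9's
torus Wilson heat-bath link sweep as the level sampler (`wilson_heatBathSweep_package` of GEN-16's
`NCMCGeneralSpaceWilsonHeatBathBar.lean`).  GEN-16's `NCMCGeneralSpaceWilsonHeatBathRestart` had
the statement from the EQUILIBRIUM start `P_F`; GEN-17's `NCMCGeneralSpaceRestartChainStart` from
almost every configuration; here: from EVERY configuration.

## Content

* **`CrooksPair.tendsto_jarzynskiEstimate_wilsonHeatBathRestart_everyStart`** — torus Wilson theory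
  (`G` compact second countable, `ρ` continuous, `L ≠ 0`), ANY Crooks pair out of `wilsonWeight ρ β`
  (to any finite `ν₁`, `e^{−ΔF} = Z₁/Z_β`), the single-link heat-bath scan over an edge list visiting
  every edge between launches: for EVERY initial gauge field `U₀` (first record launched from `U₀`),
  `ΔF̂_n → ΔF` almost surely;
* **`CrooksPair.tendsto_reweighted_wilsonHeatBathRestart_everyStart`** — and the reweighted end-point
  average of every measurable `f` with `e^{−W} f(end) ∈ L¹(P_F)` converges to `Z₁⁻¹ ∫ f dν₁` almost
  surely, from every initial gauge field.

NOT CLAIMED: rates; anything numerical.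
-/

namespace Summit.Ventures.LatticeQCDFlow.Exactness.GeneralNCMC

open MeasureTheory ProbabilityTheory Set Filter Finset
open scoped ENNReal Topology

section Wilson

open Literature.MathematicalPhysics.QuantumFieldTheory

variable {d L N : ℕ} {G : Type*} [Group G] [TopologicalSpace G] [IsTopologicalGroup G]
  (ρ : G →* Matrix (Fin N) (Fin N) ℂ) [CompactSpace G] [MeasurableSpace G] [BorelSpace G]
  [SecondCountableTopology G]

/-- **THE ENGINE'S JARZYNSKI LANE FROM EVERY INITIAL GAUGE FIELD.**  Torus Wilson theory, compact
second-countable `G`, continuous `ρ`, `L ≠ 0`; ANY Crooks pair out of `wilsonWeight ρ β` with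
`e^{−ΔF} = Z₁/Z_β`; the single-link heat-bath scan over an edge list visiting every edge between
launches.  For EVERY initial gauge field `U₀`: along the record stream whose first record is launched
from `U₀`, `ΔF̂_n → ΔF` almost surely. -/
theorem CrooksPair.tendsto_jarzynskiEstimate_wilsonHeatBathRestart_everyStart [NeZero L]
    (hρ : Continuous ρ) (β : ℝ) {l : List (Edge d L)} (hl : ∀ ed, ed ∈ l) {E : Type*}
    [MeasurableSpace E] {ν₁ : Measure (GaugeConfig d L G)} [IsFiniteMeasure ν₁]
    {κF κR : Kernel (GaugeConfig d L G) E} [IsMarkovKernel κF] [IsMarkovKernel κR]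
    {s e : E → GaugeConfig d L G} {W : E → ℝ}
    (h : CrooksPair (wilsonWeight (d := d) (L := L) ρ β) ν₁ κF κR s e W) {ΔF : ℝ}
    (hΔF : Real.exp (-ΔF) = (((wilsonWeight (d := d) (L := L) ρ β) univ)⁻¹ * ν₁ univ).toReal) :
    ∃ (_ : IsMarkovKernel (cycle (l.map (siteHeatBath (fun _ : Edge d L => haarProbability G)
        (gibbsDensity fun U : GaugeConfig d L G => β * wilsonAction ρ U))))),
      ∀ U₀ : GaugeConfig d L G, ∀ᵐ x ∂(Kernel.trajMeasure (X := fun _ : ℕ => E) (κF U₀)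
          (fun n : ℕ => ((κF ∘ₖ cycle (l.map (siteHeatBath (fun _ : Edge d L => haarProbability G)
            (gibbsDensity fun U : GaugeConfig d L G => β * wilsonAction ρ U)))).comap s
              h.measurable_s).comap
            (fun hh : (j : ↥(Finset.Iic n)) → E => hh ⟨n, Finset.mem_Iic.2 le_rfl⟩)
            (measurable_pi_apply _))),
        Tendsto (fun n : ℕ => jarzynskiEstimate (fun ε => Real.exp (-W ε)) (fun i : Fin n => x i))
          atTop (𝓝 ΔF) := by
  obtain ⟨hMk, hfin, m, hmfin, h0, hm0, hK, hmin⟩ := wilson_heatBathSweep_package ρ hρ β hl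
  haveI := hMk
  haveI := hfin
  haveI := hmfin
  exact ⟨hMk, fun U₀ => h.tendsto_jarzynskiEstimate_restartChain_everyStart _ h0 hK hΔF hm0 hmin U₀⟩

/-- **… and the reweighted end-point averages**: for every measurable `f` with
`e^{−W} f(end) ∈ L¹(P_F)` (`Z₁ ≠ 0`) and EVERY initial gauge field `U₀`,
`Σ_{i<n} e^{−W_i} f(end_i) / Σ_{i<n} e^{−W_i} → Z₁⁻¹ ∫ f dν₁` almost surely. -/
theorem CrooksPair.tendsto_reweighted_wilsonHeatBathRestart_everyStart [NeZero L]
    (hρ : Continuous ρ) (β : ℝ) {l : List (Edge d L)} (hl : ∀ ed, ed ∈ l) {E : Type*}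
    [MeasurableSpace E] {ν₁ : Measure (GaugeConfig d L G)} [IsFiniteMeasure ν₁] (h1 : ν₁ univ ≠ 0)
    {κF κR : Kernel (GaugeConfig d L G) E} [IsMarkovKernel κF] [IsMarkovKernel κR]
    {s e : E → GaugeConfig d L G} {W : E → ℝ}
    (h : CrooksPair (wilsonWeight (d := d) (L := L) ρ β) ν₁ κF κR s e W)
    {f : GaugeConfig d L G → ℝ} (hfm : Measurable f)
    (hA : Integrable (fun ε => Real.exp (-W ε) * f (e ε))
      (fwdPathLaw (wilsonWeight (d := d) (L := L) ρ β) κF)) :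
    ∃ (_ : IsMarkovKernel (cycle (l.map (siteHeatBath (fun _ : Edge d L => haarProbability G)
        (gibbsDensity fun U : GaugeConfig d L G => β * wilsonAction ρ U))))),
      ∀ U₀ : GaugeConfig d L G, ∀ᵐ x ∂(Kernel.trajMeasure (X := fun _ : ℕ => E) (κF U₀)
          (fun n : ℕ => ((κF ∘ₖ cycle (l.map (siteHeatBath (fun _ : Edge d L => haarProbability G)
            (gibbsDensity fun U : GaugeConfig d L G => β * wilsonAction ρ U)))).comap s
              h.measurable_s).comap
            (fun hh : (j : ↥(Finset.Iic n)) → E => hh ⟨n, Finset.mem_Iic.2 le_rfl⟩)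
            (measurable_pi_apply _))),
        Tendsto (fun n : ℕ => (∑ i ∈ range n, Real.exp (-W (x i)) * f (e (x i))) /
          ∑ i ∈ range n, Real.exp (-W (x i))) atTop (𝓝 (((ν₁ univ)⁻¹).toReal * ∫ y, f y ∂ν₁)) := by
  obtain ⟨hMk, hfin, m, hmfin, h0, hm0, hK, hmin⟩ := wilson_heatBathSweep_package ρ hρ β hl
  haveI := hMk
  haveI := hfin
  haveI := hmfin
  exact ⟨hMk, fun U₀ =>
    h.tendsto_reweighted_restartChain_anyLaw _ h0 h1 hK hfm hA hm0 hmin (κF U₀)⟩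

end Wilson

end Summit.Ventures.LatticeQCDFlow.Exactness.GeneralNCMC
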